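import Literature.Probability.LatticeModels.PlaneRotatorLROProofs
import Literature.Probability.LatticeModels.AnisotropicPlaneRotatorLRO
import Literature.Probability.LatticeModels.TorusFourierWienerBound
import Literature.Probability.LatticeModels.PlaneRotatorPathFloor
import HarnessLib

/-!
# The infrared ENERGY floor: Gaussian domination caps the mean energy of `ν`-vector models at the
# equipartition value, and the 2D plane-rotator bond energy obeys `E_L(K) ≥ 1 − (1 − L⁻²)/(2K)`

Topic `Literature/Probability/LatticeModels`. A corollary of the infrared bound (Fröhlich–Simon–Spencer
1976, Thm. 3.1; S. Friedli, Y. Velenik, *Statistical Mechanics of Lattice Systems*, CUP 2017, **Thm. 10.24**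
— in the tree `FriedliVelenik2017_nVector_infraredBound(_holds)`: for the `ν`-vector model
`ℋ_{L;β}(ω) = β ∑_x ∑_i ‖ω(x+eᵢ) − ω(x)‖²` on the torus `(ℤ/Lℤ)^d`, `L` even, and every `k ≠ 0`,
`|𝕋_L|⁻¹⟨‖ω̂(k)‖²⟩_{L;β} ≤ ν/(4βε(p_k))`, `ε(p) = ∑ᵢ(1 − cos pᵢ)`) read on the ENERGY instead of on the
zero mode: since `ℋ_{L;β} = β|𝕋_L|⁻¹ ∑_k 2ε(p_k)‖ω̂(k)‖²` (gradient Plancherel), summing the mode bounds gives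

  **`⟨ℋ_{L;β}⟩_{L;β} ≤ ν(|𝕋_L| − 1)/2`**                                        (`integral_nVectorHamiltonian_le`)

— Gaussian domination caps the mean energy at the equipartition value of the `ν(|𝕋_L| − 1)` non-zero
Gaussian modes (Friedli–Velenik Example 10.22: for unit spins `ℋ = 2β ∑_{bonds}(1 − S_x·S_y)`). For the
plane rotator (`ν = 2`, single-spin law `(cos, sin)_* Leb|_{[0,2π]}`, `β = K/2`, i.e. weight
`exp(K ∑_{(z,i)} cos(θ_{z+eᵢ} − θ_z))`, in every dimension `d`) this is the **infrared energy floor**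

  `∑_{(z,i)} (1 − ⟨cos(θ_{z+eᵢ} − θ_z)⟩_K) ≤ (L^d − 1)/K`                       (`torusXY_sum_one_sub_energy_le`),

and on `(ℤ/Lℤ)²`, where all `2L²` bond energies coincide (`torusXYBondEnergy_eq`),

  **`E_L(K) ≥ 1 − (1 − L⁻²)/(2K) ≥ 1 − 1/(2K)`**   (`L` even, `L ≥ 4`, `K > 0`; `torusXYBondEnergy_ge_infrared(')`):

the spin-wave deficit `T/(4J)` per bond bounds the true deficit from above, uniformly in the volume.

## Contents (everything PROVED; no named facts)

* §1 Fourier identities on `(ℤ/Lℤ)^d`: `torusChar_single_re` (`Re χ_k(eᵢ) = cos pᵢ`),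
  `norm_torusChar_single_sub_one_sq` (`‖χ_k(eᵢ) − 1‖² = 2(1 − cos pᵢ)`), **`sum_norm_shift_sub_sq`**
  (gradient Plancherel `L^d ∑_x ‖f(x+eᵢ) − f(x)‖² = ∑_k 2(1 − cos pᵢ)‖f̂(k)‖²`, from the tree's shift theorem
  `torusFourier_diff` and Parseval `torusFourier_plancherel_holds`), `nVectorHamiltonian_eq_sum_dispersion`.
* §2 `nVectorGibbs_absolutelyContinuous`, `integrable_nVectorGibbs_of_continuous` (continuous observables
  are integrable for compactly supported single-spin laws), **`integral_nVectorHamiltonian_le`**.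
* §3 The plane rotator in every dimension (single-spin law `(cos, sin)_* Leb|_{[0,2π]}` written out):
  `nVectorHamiltonian_cosSin_eq` (`ℋ_β = 2βdL^d − 2β∑cos`, Example 10.22),
  **`integral_nVectorHamiltonian_cosSin`** (`⟨ℋ_{K/2}⟩ = K(dL^d − ∑_b ⟨cos ∇θ_b⟩_K)`, the bond energies being
  the `BondSystem.expectJ` expectations of `torusXY d L` at uniform coupling `K`: change of variables to
  the angle cube `PlaneRotator.integral_nVectorRef_map_angleLaw`, then the angle cube is the Haar torus,
  `AnisotropicRotator.twoPoint_div_eq_ginibreExpect_fun`), **`torusXY_sum_one_sub_energy_le`**.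
* §4 `d = 2`: **`torusXYBondEnergy_ge_infrared`** (`E_L(K) ≥ 1 − (1 − L⁻²)/(2K)`), `…_ge_infrared'`
  (`≥ 1 − 1/(2K)`), `torusXYBondEnergy_mem_Icc_infrared` — the two-sided kernel window
  **`max(u(K), 1 − (1 − L⁻²)/(2K)) ≤ E_L(K) ≤ 8K/(1 + 8K)`** with the two-spin Ginibre floor `u = I₁/I₀`
  (`besselRatio_le_torusXYBondEnergy`, `PlaneRotatorPathFloor.lean`) and the local-Ward ceiling
  (`torusXYBondEnergy_le`, `PlaneRotatorEnergyRenormalizedDecay.lean`); `infraredFloor_le_of_admissible`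
  and **`energyExponent_le_of_admissible_infrared`**: every admissible energy ceiling `E ≥ E_L(cosh(q log 2)·K)`
  of the energy-renormalised McBryan–Spencer theorem (`torusXY_abs_expect_cosDiff_le_rpow_of_bondEnergy_le`)
  obeys `E ≥ 1 − 1/(2K)`, so the energy-class exponent `2q − 2πK·E·q²` is at most `1/(π(2K − 1))`
  (`K > ½`) — against `1/(2πK·u(K))` from the two-spin floor (`energyExponent_le_of_admissible`).

Numbers [arith, not asserted]: the infrared floor beats the two-spin floor for `K ≳ 0.85`:
`K = 1.12`: `1 − 1/(2K) = 0.554` vs `u = 0.487`, exponent ceiling `0.257` vs `0.292`;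
`K = 2`: `0.750` vs `0.698`, `0.106` vs `0.114`; `K = 0.7`: `0.286 < u = 0.330` (no gain).

Reading (cell `pub/hubbard-tc`, MO-S3, crux №2 classical side): the `η`-route inputs — the ENERGY window of
the classical comparison model — now read `u(K) ∨ (1 − (1 − L⁻²)/(2K)) ≤ E_L(K) ≤ 8K/(1 + 8K)` on even tori,
uniformly in `L`; number-neutral for every (G1) row (classical rotator, not the Hubbard model).

## Hypotheses, stated as the infrared bound needs them

`L` even and `L ≥ 4` (reflection positivity through bond-bisecting planes; the tree's infrared bound is
proved under exactly these); `K > 0` (`β > 0`); `d` arbitrary in §1–§3 (`L ≥ 2` for the Fourier identities),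
`d = 2` in §4 only because the bond-symmetry lemma `torusXYBondEnergy_eq` is stated there.

## What this is not

Not a decay estimate, not a statement about `Υ_L`, nothing about electrons or any material number; the odd-`L`
tori are not covered (no reflection positivity); no thermodynamic limit is taken (the bounds are uniform in `L`).

## References

* S. Friedli, Y. Velenik, *Statistical Mechanics of Lattice Systems*, CUP 2017, Thm. 10.24 (infrared bound),
  §10.5.1 Example 10.22 (`O(N)` models as `ν`-vector models, `‖S_i − S_j‖² = 2 − 2S_i·S_j`), §10.5.2
  (10.39)–(10.40) (Plancherel), §10.4 (discrete Fourier analysis). [FriedliVelenik2017] [FriedliVelenikSMLS2017]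
* J. Fröhlich, B. Simon, T. Spencer, Comm. Math. Phys. 50 (1976) 79–95, Thm. 3.1 (the infrared bound).
  [FrohlichSimonSpencer1976]
* O. A. McBryan, T. Spencer, Comm. Math. Phys. 53 (1977) 299 (the exponent `2q − 2πKq²`, here with the bond
  energy; tree `PlaneRotatorEnergyRenormalizedDecay.lean`). [McBryanSpencer1977]
* E. H. Lieb, Comm. Math. Phys. 77 (1980) 127, eq. (25) (two-spin value `I₁/I₀`); M. Aizenman, B. Simon,
  Comm. Math. Phys. 77 (1980) 137, eq. (2.4) (energy ceiling) — via the tree. [Lieb1980] [AizenmanSimon1980LocalWard]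

Tree: `FriedliVelenik2017_nVector_infraredBound_holds`, `nVectorGibbs`, `nVectorHamiltonian`,
`spinFourierNormSq`, `torusFourier(_diff/_plancherel_holds)`, `torusChar(_re)`, `dispersion`, `latticeMomentum`,
`NVector.integral_nVectorGibbs / ae_pi_forall_mem / card_torusSite_real / continuous_spinFourierNormSq`,
`PlaneRotator.integral_nVectorRef_map_angleLaw / continuous_cosSin / sum_cosSin_sub_sq / map_angleLaw_ne_zero /
exists_isCompact_map_angleLaw / integrableOn_angleCube`, `setIntegral_angleCube_comp_exp`,
`AnisotropicRotator.twoPoint_div_eq_ginibreExpect_fun / ginibreWeight_diffChar_exp_fun`, `torusXY`,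
`BondSystem.expectJ / bondChar`, `torusXYBondEnergy(_eq/_le)`, `PlaneRotator.besselRatio`,
`besselRatio_le_torusXYBondEnergy`, `energyExponent_le_inv`.
-/

noncomputable section

open MeasureTheory Finset Filter
open scoped BigOperators Real ComplexConjugate

namespace Literature.Probability.LatticeModels

/-! ## §1 Fourier identities on `(ℤ/Lℤ)^d`: the gradient Plancherel formula -/

section Fourier

variable {d L : ℕ} [NeZero L]

/-- `Re χ_k(eᵢ) = cos pᵢ`, `p = 2πk/L` the lattice momentum (`L ≥ 2`). [cite: FriedliVelenik2017, §10.4] -/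
theorem torusChar_single_re (hL : 2 ≤ L) (k : TorusSite d L) (i : Fin d) :
    (torusChar k (Pi.single i 1)).re = Real.cos (latticeMomentum L k i) := by
  haveI : Fact (1 < L) := ⟨hL⟩
  rw [torusChar_re]
  congr 1
  rw [Finset.sum_eq_single i (fun j _ hj => by rw [Pi.single_eq_of_ne hj, ZMod.val_zero]; simp)
    (fun h => (h (Finset.mem_univ i)).elim), Pi.single_eq_same, ZMod.val_one]
  simp

/-- `‖χ_k(eᵢ) − 1‖² = 2(1 − cos pᵢ)` for a unimodular character value. [cite: FriedliVelenik2017, §10.4] -/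
theorem norm_torusChar_single_sub_one_sq (hL : 2 ≤ L) (k : TorusSite d L) (i : Fin d) :
    ‖torusChar k (Pi.single i 1) - 1‖ ^ 2 = 2 * (1 - Real.cos (latticeMomentum L k i)) := by
  rw [← torusChar_single_re hL k i, Complex.sq_norm, Complex.normSq_apply]
  have h1 : Complex.normSq (torusChar k (Pi.single i 1)) = 1 := by
    rw [Complex.normSq_eq_norm_sq, norm_torusChar, one_pow]
  rw [Complex.normSq_apply] at h1
  simp only [Complex.sub_re, Complex.one_re, Complex.sub_im, Complex.one_im, sub_zero]
  nlinarith [h1]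

/-- **Gradient Plancherel**: `L^d ∑_x ‖f(x + eᵢ) − f(x)‖² = ∑_k 2(1 − cos pᵢ) ‖f̂(k)‖²` (shift theorem
`(f(·+eᵢ) − f)^ = (χ(eᵢ) − 1) f̂` and Parseval). [cite: FriedliVelenik2017, §10.4 (discrete Fourier analysis on the torus; Parseval)] -/
theorem sum_norm_shift_sub_sq (hL : 2 ≤ L) (f : TorusSite d L → ℂ) (i : Fin d) :
    (L : ℝ) ^ d * ∑ x, ‖f (x + Pi.single i 1) - f x‖ ^ 2 =
      ∑ k, 2 * (1 - Real.cos (latticeMomentum L k i)) * ‖torusFourier f k‖ ^ 2 := by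
  have hP := torusFourier_plancherel_holds (d := d) (L := L) (fun x => f (x + Pi.single i 1) - f x)
  rw [← hP]
  refine Finset.sum_congr rfl fun k _ => ?_
  rw [torusFourier_diff, norm_mul, mul_pow, norm_torusChar_single_sub_one_sq hL]

/-- **The `ν`-vector Hamiltonian in Fourier modes**:
`ℋ_{L;β}(ω) = β L^{−d} ∑_k 2ε(p_k) ‖ω̂(k)‖²`, `ε(p) = ∑ᵢ(1 − cos pᵢ)`,
`‖ω̂(k)‖² = ∑_a |(ω^a)^(k)|²` (`spinFourierNormSq`). [cite: FriedliVelenik2017, §10.5.2 (Fourier representation of the gradient Hamiltonian (10.38))] -/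
theorem nVectorHamiltonian_eq_sum_dispersion {ν : ℕ} (hL : 2 ≤ L) (β : ℝ) (ω : VecConfig d L ν) :
    nVectorHamiltonian β ω =
      β * ((1 / (L : ℝ) ^ d) *
        ∑ k, 2 * dispersion (latticeMomentum L k) * spinFourierNormSq ω k) := by
  have hLd : (L : ℝ) ^ d ≠ 0 := pow_ne_zero _ (Nat.cast_ne_zero.2 (NeZero.ne L))
  -- componentwise gradient Plancherel, summed over directions and components
  have hcomp : ∀ (i : Fin d) (a : Fin ν),
      (L : ℝ) ^ d * ∑ x, (ω (x + Pi.single i 1) a - ω x a) ^ 2 =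
        ∑ k, 2 * (1 - Real.cos (latticeMomentum L k i)) *
          ‖torusFourier (fun x => (ω x a : ℂ)) k‖ ^ 2 := by
    intro i a
    rw [← sum_norm_shift_sub_sq hL (fun x => (ω x a : ℂ)) i]
    congr 1
    refine Finset.sum_congr rfl fun x _ => ?_
    rw [← Complex.ofReal_sub, Complex.norm_real, Real.norm_eq_abs, sq_abs]
  unfold nVectorHamiltonian spinFourierNormSq dispersion
  congr 1
  -- reduce to `L^d · (∑_x ∑_i ∑_a) = ∑_k 2ε ∑_a`
  rw [eq_comm, ← mul_right_inj' hLd, ← mul_assoc, mul_one_div_cancel hLd, one_mul]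
  -- left: `∑_k 2(∑_i e k i)(∑_a n k a) = ∑_i ∑_a ∑_k 2 e k i n k a`
  have hL1 : ∑ k : TorusSite d L, 2 * (∑ i : Fin d, (1 - Real.cos (latticeMomentum L k i))) *
      ∑ a : Fin ν, ‖torusFourier (fun x => (ω x a : ℂ)) k‖ ^ 2 =
      ∑ i : Fin d, ∑ a : Fin ν, ∑ k : TorusSite d L, 2 * (1 - Real.cos (latticeMomentum L k i)) *
        ‖torusFourier (fun x => (ω x a : ℂ)) k‖ ^ 2 := by
    have h1 : ∀ k : TorusSite d L, 2 * (∑ i : Fin d, (1 - Real.cos (latticeMomentum L k i))) *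
        ∑ a : Fin ν, ‖torusFourier (fun x => (ω x a : ℂ)) k‖ ^ 2 =
        ∑ i : Fin d, ∑ a : Fin ν, 2 * (1 - Real.cos (latticeMomentum L k i)) *
          ‖torusFourier (fun x => (ω x a : ℂ)) k‖ ^ 2 := fun k => by
      symm
      calc ∑ i : Fin d, ∑ a : Fin ν, 2 * (1 - Real.cos (latticeMomentum L k i)) *
            ‖torusFourier (fun x => (ω x a : ℂ)) k‖ ^ 2
          = ∑ i : Fin d, 2 * (1 - Real.cos (latticeMomentum L k i)) *
              ∑ a : Fin ν, ‖torusFourier (fun x => (ω x a : ℂ)) k‖ ^ 2 :=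
            Finset.sum_congr rfl fun i _ => by rw [Finset.mul_sum]
        _ = (∑ i : Fin d, 2 * (1 - Real.cos (latticeMomentum L k i))) *
              ∑ a : Fin ν, ‖torusFourier (fun x => (ω x a : ℂ)) k‖ ^ 2 := by rw [Finset.sum_mul]
        _ = _ := by rw [← Finset.mul_sum]
    simp_rw [h1]
    rw [Finset.sum_comm]
    exact Finset.sum_congr rfl fun i _ => Finset.sum_comm
  -- right: `L^d ∑_x ∑_i ∑_a g = ∑_i ∑_a L^d ∑_x g`
  have hR1 : (L : ℝ) ^ d * ∑ x : TorusSite d L, ∑ i : Fin d, ∑ a : Fin ν,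
      (ω (x + Pi.single i 1) a - ω x a) ^ 2 =
      ∑ i : Fin d, ∑ a : Fin ν, (L : ℝ) ^ d * ∑ x : TorusSite d L,
        (ω (x + Pi.single i 1) a - ω x a) ^ 2 := by
    have h2 : ∑ x : TorusSite d L, ∑ i : Fin d, ∑ a : Fin ν, (ω (x + Pi.single i 1) a - ω x a) ^ 2 =
        ∑ i : Fin d, ∑ a : Fin ν, ∑ x : TorusSite d L, (ω (x + Pi.single i 1) a - ω x a) ^ 2 := by
      rw [Finset.sum_comm]
      exact Finset.sum_congr rfl fun i _ => Finset.sum_comm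
    rw [h2, Finset.mul_sum]
    exact Finset.sum_congr rfl fun i _ => by rw [Finset.mul_sum]
  rw [hL1, hR1]
  exact Finset.sum_congr rfl fun i _ => Finset.sum_congr rfl fun a _ => (hcomp i a).symm

end Fourier

/-! ## §2 Gaussian domination caps the mean energy at the equipartition value -/

section Equipartition

variable {d L ν : ℕ} [NeZero L]

/-- The Gibbs distribution is absolutely continuous with respect to the reference product measure.
[cite: FriedliVelenik2017, §10.5.1 (Gibbs distribution (10.5) as a density against μ₀)] -/
theorem nVectorGibbs_absolutelyContinuous (ρ : Measure (Fin ν → ℝ)) (β : ℝ) :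
    nVectorGibbs (d := d) (L := L) ρ β ≪ nVectorRef (d := d) (L := L) ρ := by
  unfold nVectorGibbs
  exact (withDensity_absolutelyContinuous _ _).smul_left _

/-- A continuous observable is integrable against the Gibbs distribution of a compactly supported
single-spin law (it is bounded on the compact product of the supports, which carries the measure).
[cite: FriedliVelenik2017, §10.5.1 (standing assumption: ρ compactly supported)] -/
theorem integrable_nVectorGibbs_of_continuous (ρ : Measure (Fin ν → ℝ)) [IsFiniteMeasure ρ]
    (hKex : ∃ K₀ : Set (Fin ν → ℝ), IsCompact K₀ ∧ ρ K₀ᶜ = 0) (hρ : ρ ≠ 0) {β : ℝ} (hβ : 0 ≤ β)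
    {F : VecConfig d L ν → ℝ} (hF : Continuous F) :
    Integrable F (nVectorGibbs (d := d) (L := L) ρ β) := by
  obtain ⟨K₀, hKc, hK⟩ := hKex
  haveI := isProbabilityMeasure_nVectorGibbs (d := d) (L := L) ρ hρ hβ
  have hcpt : IsCompact (Set.pi Set.univ fun _ : TorusSite d L => K₀) :=
    isCompact_univ_pi fun _ => hKc
  obtain ⟨C, hC⟩ := hcpt.exists_bound_of_continuousOn hF.continuousOn
  have hae : ∀ᵐ ω ∂(nVectorGibbs (d := d) (L := L) ρ β), ∀ x, ω x ∈ K₀ :=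
    nVectorGibbs_absolutelyContinuous ρ β (NVector.ae_pi_forall_mem ρ hK)
  exact Integrable.of_bound hF.aestronglyMeasurable C
    (hae.mono fun ω hω => hC ω fun i _ => hω i)

/-- **The infrared ENERGY ceiling (equipartition bound).** For the `ν`-vector model (10.38) on the torus
`(ℤ/Lℤ)^d`, `L` even, `L ≥ 4`, with a nonzero finite compactly supported single-spin law `ρ` and
`β > 0`: **`⟨ℋ_{L;β}⟩_{L;β} ≤ ν(|𝕋_L| − 1)/2`** — the mean energy never exceeds the equipartition value
of the `ν(|𝕋_L| − 1)` Gaussian modes. Proof: `ℋ = β|𝕋|⁻¹∑_k 2ε(p_k)‖ω̂(k)‖²` (gradient Plancherel) and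
the infrared bound `|𝕋|⁻¹⟨‖ω̂(k)‖²⟩ ≤ ν/(4βε(p_k))` mode by mode for `k ≠ 0` (Friedli–Velenik Thm. 10.24,
tree `FriedliVelenik2017_nVector_infraredBound_holds`); the zero mode carries no energy.
[cite: FriedliVelenik2017, Thm. 10.24 (infrared bound), §10.5.2] -/
theorem integral_nVectorHamiltonian_le (hLe : Even L) (hL4 : 4 ≤ L) (ρ : Measure (Fin ν → ℝ))
    [IsFiniteMeasure ρ] (hKex : ∃ K₀ : Set (Fin ν → ℝ), IsCompact K₀ ∧ ρ K₀ᶜ = 0) (hρ : ρ ≠ 0)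
    {β : ℝ} (hβ : 0 < β) :
    ∫ ω, nVectorHamiltonian β ω ∂(nVectorGibbs (d := d) (L := L) ρ β) ≤
      ν * ((L : ℝ) ^ d - 1) / 2 := by
  have hIR := (FriedliVelenik2017_nVector_infraredBound_holds d L ν hLe hL4 ρ hKex hρ β hβ).1
  have hL2 : 2 ≤ L := by omega
  set G := nVectorGibbs (d := d) (L := L) ρ β with hG
  have hint : ∀ k, Integrable (fun ω => spinFourierNormSq ω k) G := fun k =>
    integrable_nVectorGibbs_of_continuous ρ hKex hρ hβ.le (NVector.continuous_spinFourierNormSq k)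
  set e : TorusSite d L → ℝ := fun k => dispersion (latticeMomentum L k) with he
  -- the Hamiltonian in Fourier modes, integrated
  have hH : ∫ ω, nVectorHamiltonian β ω ∂G =
      β * ∑ k, 2 * e k * ((1 / (L : ℝ) ^ d) * ∫ ω, spinFourierNormSq ω k ∂G) := by
    simp_rw [nVectorHamiltonian_eq_sum_dispersion hL2 β]
    rw [integral_const_mul, integral_const_mul,
      integral_finsetSum _ fun k _ => ((hint k).const_mul (2 * e k))]
    congr 1
    rw [Finset.mul_sum]
    refine Finset.sum_congr rfl fun k _ => ?_
    rw [integral_const_mul]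
    ring
  -- mode-by-mode bound
  have hterm : ∀ k, 2 * e k * ((1 / (L : ℝ) ^ d) * ∫ ω, spinFourierNormSq ω k ∂G) ≤
      if k = 0 then 0 else ν / (2 * β) := by
    intro k
    split_ifs with hk
    · have h0 : e k = 0 := (dispersion_latticeMomentum_eq_zero_iff_holds (d := d) (L := L) k).2 hk
      rw [h0, mul_zero, zero_mul]
    · have hε0 : 0 < e k := lt_of_le_of_ne (dispersion_nonneg _)
        (Ne.symm fun h => hk ((dispersion_latticeMomentum_eq_zero_iff_holds (d := d) (L := L) k).1 h))
      have h := mul_le_mul_of_nonneg_left (hIR k hk) (by positivity : (0 : ℝ) ≤ 2 * e k)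
      refine h.trans (le_of_eq ?_)
      have hek : dispersion (latticeMomentum L k) = e k := rfl
      rw [hek]
      field_simp
      ring
  -- sum of the mode bounds: `(|𝕋| − 1) · ν/(2β)`
  have hsum : ∑ k : TorusSite d L, (if k = 0 then (0 : ℝ) else ν / (2 * β)) =
      ((L : ℝ) ^ d - 1) * (ν / (2 * β)) := by
    rw [← Finset.add_sum_erase _ _ (Finset.mem_univ (0 : TorusSite d L)), if_pos rfl, zero_add,
      Finset.sum_congr rfl fun k hk => if_neg (Finset.ne_of_mem_erase hk), Finset.sum_const,
      Finset.card_erase_of_mem (Finset.mem_univ _), nsmul_eq_mul, Finset.card_univ,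
      Nat.cast_sub Fintype.card_pos, Nat.cast_one, NVector.card_torusSite_real]
  rw [hH]
  calc β * ∑ k, 2 * e k * ((1 / (L : ℝ) ^ d) * ∫ ω, spinFourierNormSq ω k ∂G)
      ≤ β * ∑ k : TorusSite d L, (if k = 0 then (0 : ℝ) else ν / (2 * β)) :=
        mul_le_mul_of_nonneg_left (Finset.sum_le_sum fun k _ => hterm k) hβ.le
    _ = ν * ((L : ℝ) ^ d - 1) / 2 := by
        rw [hsum]
        field_simp

end Equipartition

/-! ## §3 The plane rotator: `ν = 2`, single-spin law `(cos, sin)_* Leb|_{[0,2π]}`, `β = K/2` -/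

section PlaneRotator

open PlaneRotator

variable {d L : ℕ} [NeZero L]

/-- **Example 10.22 for `ν = 2` in every dimension**: on unit plane spins in angles,
`ℋ_{L;β}((cos θ_x, sin θ_x)_x) = 2β·d·L^d − 2β ∑_{(x,i)} cos(θ_{x+eᵢ} − θ_x)`.
[cite: FriedliVelenikSMLS2017, §10.5.1 Example 10.22 (‖S_i − S_j‖² = 2 − 2 S_i·S_j)] -/
theorem nVectorHamiltonian_cosSin_eq (β : ℝ) (θ : TorusSite d L → ℝ) :
    nVectorHamiltonian β (fun x => (![Real.cos (θ x), Real.sin (θ x)] : Fin 2 → ℝ)) =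
      2 * β * d * (L : ℝ) ^ d -
        2 * β * ∑ b : TorusSite d L × Fin d, Real.cos (θ (b.1 + Pi.single b.2 1) - θ b.1) := by
  unfold nVectorHamiltonian
  simp_rw [sum_cosSin_sub_sq]
  rw [Fintype.sum_prod_type]
  dsimp only
  have h : ∀ x : TorusSite d L, ∑ i : Fin d, (2 - 2 * Real.cos (θ (x + Pi.single i 1) - θ x)) =
      2 * d - 2 * ∑ i : Fin d, Real.cos (θ (x + Pi.single i 1) - θ x) := by
    intro x
    rw [Finset.sum_sub_distrib, ← Finset.mul_sum, Finset.sum_const, Finset.card_univ,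
      Fintype.card_fin, nsmul_eq_mul]
    ring
  simp_rw [h]
  rw [Finset.sum_sub_distrib, Finset.sum_const, Finset.card_univ, nsmul_eq_mul,
    NVector.card_torusSite_real, ← Finset.mul_sum]
  ring

/-- The bond characters of `torusXY d L` are the relative-angle characters `θ̄_z θ_{z+eᵢ}`. [folklore] -/
private theorem torusXY_bondChar_eq (d L : ℕ) :
    (torusXY d L).bondChar = fun b : TorusSite d L × Fin d => diffChar b.1 (b.1 + Pi.single b.2 1) :=
  rfl

/-- **The mean energy of the plane rotator is `K·(d·L^d − ∑_b E_b(K))`**: for the `2`-vector model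
with the cos/sin law at `β = K/2` (`K ≥ 0`), `⟨ℋ_{L;K/2}⟩ = K(dL^d − ∑_{(z,i)} ⟨cos(θ_{z+eᵢ} − θ_z)⟩_K)`,
the bond energies being the Ginibre/`BondSystem.expectJ` expectations of `torusXY d L` at uniform
coupling `K` (change of variables to the angle cube, where the Boltzmann weight of (10.38) is
`e^{−KdL^d}` times the XY weight; then the angle cube is the Haar torus).
[cite: FriedliVelenikSMLS2017, §10.5.1 Example 10.22 and §10.5.2] -/
theorem integral_nVectorHamiltonian_cosSin {K : ℝ} (hK : 0 ≤ K) :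
    ∫ ω, nVectorHamiltonian (K / 2) ω ∂(nVectorGibbs (d := d) (L := L)
        (Measure.map (fun t : ℝ => (![Real.cos t, Real.sin t] : Fin 2 → ℝ))
          (volume.restrict (Set.Icc (0 : ℝ) (2 * π)))) (K / 2)) =
      K * (d * (L : ℝ) ^ d -
        ∑ b : TorusSite d L × Fin d,
          (torusXY d L).expectJ (fun _ => K) (reChar ((torusXY d L).bondChar b))) := by
  -- the XY weight `w` and the constant `a = e^{-KdL^d}` relating it to the weight of (10.38)
  set w : (TorusSite d L → ℝ) → ℝ := fun θ => Real.exp (∑ b : TorusSite d L × Fin d,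
    K * Real.cos (θ (b.1 + Pi.single b.2 1) - θ b.1)) with hw
  have hwc : Continuous w := by
    rw [hw]
    fun_prop
  set a : ℝ := Real.exp (-(K * d * (L : ℝ) ^ d)) with ha
  have ha0 : a ≠ 0 := (Real.exp_pos _).ne'
  set Hθ : (TorusSite d L → ℝ) → ℝ := fun θ =>
    K * (d * (L : ℝ) ^ d) - K * ∑ b : TorusSite d L × Fin d,
      Real.cos (θ (b.1 + Pi.single b.2 1) - θ b.1) with hHθ
  have hHam : ∀ θ : TorusSite d L → ℝ, nVectorHamiltonian (K / 2)
      (fun x => (![Real.cos (θ x), Real.sin (θ x)] : Fin 2 → ℝ)) = Hθ θ := by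
    intro θ
    rw [nVectorHamiltonian_cosSin_eq, hHθ]
    ring
  have hexp : ∀ θ : TorusSite d L → ℝ, Real.exp (-nVectorHamiltonian (K / 2)
      (fun x => (![Real.cos (θ x), Real.sin (θ x)] : Fin 2 → ℝ))) = a * w θ := by
    intro θ
    rw [hHam, hHθ, ha, hw, ← Real.exp_add]
    congr 1
    rw [← Finset.mul_sum]
    ring
  have h1 : Continuous fun ω : VecConfig d L 2 =>
      Real.exp (-nVectorHamiltonian (K / 2) ω) * nVectorHamiltonian (K / 2) ω :=
    (continuous_nVectorHamiltonian _).neg.rexp.mul (continuous_nVectorHamiltonian _)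
  have h2 : Continuous fun ω : VecConfig d L 2 => Real.exp (-nVectorHamiltonian (K / 2) ω) :=
    (continuous_nVectorHamiltonian _).neg.rexp
  rw [NVector.integral_nVectorGibbs _ (map_angleLaw_ne_zero continuous_cosSin.measurable)
      (by positivity : (0 : ℝ) ≤ K / 2),
    nVectorPartitionFunction, integral_nVectorRef_map_angleLaw continuous_cosSin _ h1,
    integral_nVectorRef_map_angleLaw continuous_cosSin _ h2]
  simp_rw [hexp, hHam]
  -- split the numerator
  have hintw : Integrable w (volume.restrict (Set.pi Set.univ fun _ => Set.Icc (0 : ℝ) (2 * π))) :=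
    integrableOn_angleCube hwc
  have hintc : ∀ b : TorusSite d L × Fin d, Integrable (fun θ : TorusSite d L → ℝ =>
      Real.cos (θ (b.1 + Pi.single b.2 1) - θ b.1) * w θ)
        (volume.restrict (Set.pi Set.univ fun _ => Set.Icc (0 : ℝ) (2 * π))) := fun b =>
    integrableOn_angleCube (by fun_prop)
  have hnum : ∀ θ : TorusSite d L → ℝ, a * w θ * Hθ θ =
      a * ((K * (d * (L : ℝ) ^ d)) * w θ - K * ∑ b : TorusSite d L × Fin d,
        Real.cos (θ (b.1 + Pi.single b.2 1) - θ b.1) * w θ) := by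
    intro θ
    simp only [hHθ]
    rw [← Finset.sum_mul]
    ring
  simp_rw [hnum]
  rw [integral_const_mul, integral_const_mul, mul_div_mul_left _ _ ha0,
    integral_sub (hintw.const_mul _) ((integrable_finsetSum _ fun b _ => hintc b).const_mul _),
    integral_const_mul, integral_const_mul, integral_finsetSum _ fun b _ => hintc b]
  have hZ : 0 < ∫ θ in Set.pi Set.univ fun _ => Set.Icc (0 : ℝ) (2 * π), w θ := by
    have h := setIntegral_angleCube_comp_exp (V := TorusSite d L)
      (fun u => ginibreWeight (torusXY d L).bondChar (fun _ => K) u)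
      ((continuous_ginibreWeight _ _).aestronglyMeasurable)
    simp only [torusXY_bondChar_eq, AnisotropicRotator.ginibreWeight_diffChar_exp_fun, smul_eq_mul] at h
    rw [hw, h]
    exact mul_pos (by positivity) (integral_exp_pos
      (integrable_torusHaar_of_continuous (continuous_ginibreWeight _ _)))
  rw [sub_div, mul_div_assoc, div_self hZ.ne', mul_one, mul_div_assoc, Finset.sum_div, mul_sub]
  congr 2
  exact Finset.sum_congr rfl fun b _ => by
    rw [BondSystem.expectJ, torusXY_bondChar_eq]
    exact AnisotropicRotator.twoPoint_div_eq_ginibreExpect_fun (V := TorusSite d L) Prod.fst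
      (fun b : TorusSite d L × Fin d => b.1 + Pi.single b.2 1) (fun _ => K) (b.1 + Pi.single b.2 1) b.1

/-- **The infrared energy floor of the plane rotator on `(ℤ/Lℤ)^d`** (`L` even, `L ≥ 4`, `K > 0`): the
total bond-energy deficit is at most `(L^d − 1)/K`,
`∑_{(z,i)} (1 − ⟨cos(θ_{z+eᵢ} − θ_z)⟩_K) ≤ (L^d − 1)/K` — Gaussian domination (the infrared bound) caps
the mean energy `K·∑(1 − cos)` at the equipartition value `L^d − 1` of the `2(L^d − 1)` transverse and
longitudinal Gaussian modes. [cite: FriedliVelenik2017, Thm. 10.24 (infrared bound) with Example 10.22] -/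
theorem torusXY_sum_one_sub_energy_le (hLe : Even L) (hL4 : 4 ≤ L) {K : ℝ} (hK : 0 < K) :
    ∑ b : TorusSite d L × Fin d,
        (1 - (torusXY d L).expectJ (fun _ => K) (reChar ((torusXY d L).bondChar b))) ≤
      ((L : ℝ) ^ d - 1) / K := by
  have h := integral_nVectorHamiltonian_le (d := d) (L := L) (ν := 2) hLe hL4
    (Measure.map (fun t : ℝ => (![Real.cos t, Real.sin t] : Fin 2 → ℝ))
      (volume.restrict (Set.Icc (0 : ℝ) (2 * π))))
    (exists_isCompact_map_angleLaw continuous_cosSin)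
    (map_angleLaw_ne_zero continuous_cosSin.measurable) (β := K / 2) (by positivity)
  rw [integral_nVectorHamiltonian_cosSin hK.le] at h
  have hsum : ∑ b : TorusSite d L × Fin d,
      (1 - (torusXY d L).expectJ (fun _ => K) (reChar ((torusXY d L).bondChar b))) =
      d * (L : ℝ) ^ d - ∑ b : TorusSite d L × Fin d,
        (torusXY d L).expectJ (fun _ => K) (reChar ((torusXY d L).bondChar b)) := by
    rw [Finset.sum_sub_distrib, Finset.sum_const, Finset.card_univ, nsmul_eq_mul, mul_one,
      Fintype.card_prod, Fintype.card_fin, Nat.cast_mul, NVector.card_torusSite_real, mul_comm]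
  rw [hsum, le_div_iff₀ hK, mul_comm]
  push_cast at h
  linarith

end PlaneRotator

/-! ## §4 The torus `(ℤ/Lℤ)²`: `E_L(K) ≥ 1 − (1 − L⁻²)/(2K)` and the two-sided energy window -/

section TorusTwo

open PlaneRotator

variable {L : ℕ} [NeZero L]

/-- **`E_L(K) ≥ 1 − (1 − L⁻²)/(2K)`** for the nearest-neighbour plane rotator on `(ℤ/Lℤ)²`, `L` even,
`L ≥ 4`, `K > 0`: the spin-wave (Gaussian) energy deficit `T/(4J)` per bond, corrected by the missing
zero mode, bounds the true deficit from above (infrared bound; all `2L²` bond energies coincide,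
`torusXYBondEnergy_eq`). [cite: FriedliVelenik2017, Thm. 10.24 (infrared bound) with Example 10.22] -/
theorem torusXYBondEnergy_ge_infrared (hLe : Even L) (hL4 : 4 ≤ L) {K : ℝ} (hK : 0 < K)
    (b₀ : TorusSite 2 L × Fin 2) :
    1 - (1 - 1 / (L : ℝ) ^ 2) / (2 * K) ≤ torusXYBondEnergy L K b₀ := by
  have h := torusXY_sum_one_sub_energy_le (d := 2) hLe hL4 hK
  have hE : ∀ b, (torusXY 2 L).expectJ (fun _ => K) (reChar ((torusXY 2 L).bondChar b)) =
      torusXYBondEnergy L K b₀ := fun b => by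
    rw [torusXY_expectJ_reChar_bondChar, torusXYBondEnergy_eq K b b₀]
  simp_rw [hE] at h
  rw [Finset.sum_const, Finset.card_univ, nsmul_eq_mul, Fintype.card_prod, Fintype.card_fin,
    Nat.cast_mul, NVector.card_torusSite_real] at h
  have hL : (0 : ℝ) < (L : ℝ) ^ 2 := by
    have : (0 : ℝ) < L := Nat.cast_pos.2 (Nat.pos_of_ne_zero (NeZero.ne L))
    positivity
  push_cast at h
  have h1 : (L : ℝ) ^ 2 * 2 * (1 - torusXYBondEnergy L K b₀) * K ≤ (L : ℝ) ^ 2 - 1 :=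
    (le_div_iff₀ hK).1 h
  have h2 : (1 - 1 / (L : ℝ) ^ 2) / (2 * K) = ((L : ℝ) ^ 2 - 1) / ((L : ℝ) ^ 2 * (2 * K)) := by
    field_simp
  rw [h2, sub_le_comm, le_div_iff₀ (by positivity)]
  calc (1 - torusXYBondEnergy L K b₀) * ((L : ℝ) ^ 2 * (2 * K))
      = (L : ℝ) ^ 2 * 2 * (1 - torusXYBondEnergy L K b₀) * K := by ring
    _ ≤ (L : ℝ) ^ 2 - 1 := h1

/-- The volume-free form **`E_L(K) ≥ 1 − 1/(2K)`** (`L` even, `L ≥ 4`, `K > 0`): the classical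
spin-wave deficit `T/(4J)` per bond is an upper bound on `1 − E_L`. [cite: FriedliVelenik2017, Thm. 10.24 (infrared bound) with Example 10.22] -/
theorem torusXYBondEnergy_ge_infrared' (hLe : Even L) (hL4 : 4 ≤ L) {K : ℝ} (hK : 0 < K)
    (b₀ : TorusSite 2 L × Fin 2) :
    1 - 1 / (2 * K) ≤ torusXYBondEnergy L K b₀ := by
  refine le_trans ?_ (torusXYBondEnergy_ge_infrared hLe hL4 hK b₀)
  have hL : (0 : ℝ) < (L : ℝ) ^ 2 := by
    have : (0 : ℝ) < L := Nat.cast_pos.2 (Nat.pos_of_ne_zero (NeZero.ne L))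
    positivity
  have h : (1 - 1 / (L : ℝ) ^ 2) / (2 * K) ≤ 1 / (2 * K) :=
    div_le_div_of_nonneg_right (by rw [sub_le_self_iff]; positivity) (by positivity)
  linarith

/-- **The two-sided kernel window with the infrared floor**: for `L` even, `L ≥ 4`, `K > 0`,
`max(u(K), 1 − (1 − L⁻²)/(2K)) ≤ E_L(K) ≤ 8K/(1 + 8K)` — two-spin Ginibre floor
(`besselRatio_le_torusXYBondEnergy`), infrared floor (this file), local-Ward ceiling
(`torusXYBondEnergy_le`). The infrared floor is the better one for `K ≳ 0.85`
(`K = 1.12`: `0.554` vs `u = 0.487`; `K = 2`: `0.750` vs `0.698` [arith, not asserted]).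
[cite: FriedliVelenik2017, Thm. 10.24 with Example 10.22; Lieb1980 eq. (25); AizenmanSimon1980LocalWard eq. (2.4)] -/
theorem torusXYBondEnergy_mem_Icc_infrared (hLe : Even L) (hL4 : 4 ≤ L) {K : ℝ} (hK : 0 < K)
    (b : TorusSite 2 L × Fin 2) :
    torusXYBondEnergy L K b ∈
      Set.Icc (max (besselRatio K) (1 - (1 - 1 / (L : ℝ) ^ 2) / (2 * K))) (8 * K / (1 + 8 * K)) :=
  ⟨max_le (besselRatio_le_torusXYBondEnergy (by omega) hK.le b)
    (torusXYBondEnergy_ge_infrared hLe hL4 hK b), torusXYBondEnergy_le (by omega) hK b⟩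

/-- **Every admissible energy ceiling is at least the infrared floor**: if `E ≥ E_L(c·K)` for some
`c ≥ 1` (the hypothesis shape of `torusXY_abs_expect_cosDiff_le_rpow_of_bondEnergy_le`), then
`E ≥ 1 − 1/(2K)` (`L` even, `L ≥ 4`, `K > 0`). [cite: FriedliVelenik2017, Thm. 10.24 with Example 10.22] -/
theorem infraredFloor_le_of_admissible (hLe : Even L) (hL4 : 4 ≤ L) {K c E : ℝ} (hK : 0 < K)
    (hc : 1 ≤ c) {b : TorusSite 2 L × Fin 2} (hE : torusXYBondEnergy L (c * K) b ≤ E) :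
    1 - 1 / (2 * K) ≤ E := by
  have hcK : 0 < c * K := mul_pos (by linarith) hK
  refine le_trans ?_ ((torusXYBondEnergy_ge_infrared' hLe hL4 hcK b).trans hE)
  have h : 1 / (2 * (c * K)) ≤ 1 / (2 * K) :=
    one_div_le_one_div_of_le (by positivity) (by nlinarith)
  linarith

/-- **The energy-class exponent cannot exceed `1/(π(2K − 1))`** (`K > ½`, `L` even, `L ≥ 4`): for every
admissible energy ceiling `E ≥ E_L(cosh(q log 2)·K)` of the energy-renormalised McBryan–Spencer theorem,
`2q − 2πK·E·q² ≤ 1/(2πK(1 − 1/(2K))) = 1/(π(2K − 1))` — against the two-spin value `1/(2πK·u(K))`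
of `energyExponent_le_of_admissible` (`K = 1.12`: `0.257` vs `0.292`; `K = 2`: `0.106` vs `0.114`
[arith, not asserted]). [cite: McBryanSpencer1977, main theorem (choice of the exponent); FriedliVelenik2017 Thm. 10.24] -/
theorem energyExponent_le_of_admissible_infrared (hLe : Even L) (hL4 : 4 ≤ L) {K q E : ℝ}
    (hK : 1 / 2 < K) (hE : torusXYBondEnergy L (Real.cosh (q * Real.log 2) * K) (0, 0) ≤ E) :
    2 * q - 2 * Real.pi * (K * E) * q ^ 2 ≤ 1 / (Real.pi * (2 * K - 1)) := by
  have hK0 : 0 < K := by linarith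
  have hu : 0 < 1 - 1 / (2 * K) := by
    rw [sub_pos, div_lt_one (by positivity)]; linarith
  have h := energyExponent_le_inv hK0 hu
    (infraredFloor_le_of_admissible hLe hL4 hK0 (Real.one_le_cosh _) hE) q
  refine h.trans (le_of_eq ?_)
  have h2 : (2 : ℝ) * K - 1 ≠ 0 := by linarith
  field_simp

end TorusTwo

end Literature.Probability.LatticeModels
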